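import Mathlib
import Summits.MatrixMultiplication.MatrixMultiplication.Theorems.HiddenToeplitzCornersHiddenCornerLemmaRStein
import Summits.MatrixMultiplication.MatrixMultiplication.Theorems.HiddenToeplitzCornersHiddenCornerLemmaRTailSlot

/-!
# Stub `stub_mixedDeepBound`, case `p = 1`, `γ = 0`, GENERAL right generators

Support file for crux item `stmt-MatrixMultiplication-10752`
(`Summit.MatrixMultiplication.MatrixMultiplication.Theses.HiddenToeplitzCorners.HiddenCornerLemmaR`),
line `atkinson-lloyd-core-split`, registered special case `mixedDeepBound_p_one_row0` of the stub
`stub_mixedDeepBound` (mixed compression class `∇T a b = G₀ (H₁ a b)ᵀ + (G₁ a b) H₀ᵀ`): one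
constant left generator supported on row `0` (`p = 1`, valuation `γ = 0`), `q ≥ 1` constant right
generators `H₀` with NO support hypothesis (the landed `mixedDeepBound_row0_toric` needed `H₀`
on `≤ q` rows), hidden corner `T(X) E = F X` with `rank F = r`; conclusion `r ≤ 2(p+q)`.
We prove the sharper `r ≤ q + 2` (`hclR_mixed_row0_general_bound`), from `rank F = r` and the
corner identity alone (no nonsingular member, no deep hypothesis, nothing on `E`, `G₀`, `H₀`).

Proof.  Polynomial model `ℂ^N = ℂ[X]/(X^N)` (column `e ↦ ∑ e_n X^n`, `Z ↦ X·`;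
`hclR_tail_coeff_vp`).  Stein inversion (`hclR_stein_sum`, `hclR_eq_zero_of_stein`) writes
`T a b = ∑_j ∑_k Z^k (u_j ⊗ v_j) (Zᵀ)^k` over the `q + 1` rank-one pieces of the displacement, and
`hclR_stein_sum_mulVec` turns a column of the corner identity into
`[b = c] φ_a ≡ G₀₀₀ · corr(h_{ab}, e_c) + ∑_l g^l_{ab} · corr(w_l, e_c) (mod X^N)` (`r0g_col_congr`;
`corr(v,e) = ∑_k ⟪v, (Zᵀ)^k e⟫ X^k` the correlation polynomial, `w_l` = columns of `H₀`, `g^l_{ab}` =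
column polynomials of `G₁ a b`, `h_{ab}` = the column of `H₁ a b`).  With `q + 3` slots this is the
hypothesis of the tail-syzygy slot lemma: `hclR_tail_slot` = coordinate form of
`hclR_tail_slot_poly` (`HiddenCornerLemmaRTailSlot`) via `hclR_tail_corr_eq`
(`corr(v,e) = ∑_i v_i (e /ₘ X^i)`).  So every target column vanishes, `F = 0`, `r = 0`.
-/

-- D-0017: the single-problem layout `Summits/<S>/<S>/…` duplicates a namespace segment by design.
set_option linter.dupNamespace false

namespace Summit.MatrixMultiplication.MatrixMultiplication.Theorems

open Polynomial Matrix BigOperators Finset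

/-- Coefficients of the column polynomial `∑ C (E n) X^n` of a vector `E : Fin N → ℂ`. -/
theorem hclR_tail_coeff_vp {N : ℕ} (E : Fin N → ℂ) (j : ℕ) :
    (∑ n : Fin N, C (E n) * X ^ (n : ℕ)).coeff j = if h : j < N then E ⟨j, h⟩ else 0 := by
  rw [finsetSum_coeff]
  simp only [coeff_C_mul_X_pow]
  split_ifs with h
  · rw [Finset.sum_eq_single ⟨j, h⟩]
    · simp
    · intro n _ hn
      rw [if_neg]
      intro h'
      exact hn (Fin.ext h'.symm)
    · simp
  · exact Finset.sum_eq_zero fun n _ => by rw [if_neg]; have := n.is_lt; omega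

/-- The correlation polynomial `∑_k ⟪v, δ^k E⟫ X^k` of the Stein toolkit is the tail
`∑_i v_i · (e /ₘ X^i)` of the column polynomial `e` of `E`. -/
theorem hclR_tail_corr_eq {N : ℕ} (v E : Fin N → ℂ) :
    (∑ k ∈ Finset.range N, C (∑ i : Fin N, v i *
        (if h : (i : ℕ) + k < N then E ⟨(i : ℕ) + k, h⟩ else 0)) * X ^ k) =
      ∑ i : Fin N, C (v i) * ((∑ n : Fin N, C (E n) * X ^ (n : ℕ)) /ₘ X ^ (i : ℕ)) := by
  ext K
  rw [finsetSum_coeff, finsetSum_coeff]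
  simp only [coeff_C_mul_X_pow]
  simp only [coeff_C_mul, hclR_tail_coeff_divByMonic_X_pow, hclR_tail_coeff_vp]
  rw [Finset.sum_ite_eq]
  by_cases hK : K < N
  · rw [if_pos (Finset.mem_range.mpr hK)]
    refine Finset.sum_congr rfl fun i _ => ?_
    congr 1
    by_cases h : (i : ℕ) + K < N
    · rw [dif_pos h, dif_pos (by omega)]
      congr 1
      exact Fin.ext (Nat.add_comm _ _)
    · rw [dif_neg h, dif_neg (by omega)]
  · rw [if_neg (fun h => hK (Finset.mem_range.mp h))]
    symm
    refine Finset.sum_eq_zero fun i _ => ?_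
    rw [dif_neg (by omega), mul_zero]

/-- **Slot lemma for the row-`0` mixed class with general right generators (coordinate form).**
With `q + 3` slots: if for all slots `b, c` the column identity
`c_b · corr(η_b, E_c) + ∑_l γ_{b l} · corr(w_l, E_c) ≡ [b = c] · f (mod X^N)` holds, where
`corr(v, E) = ∑_{k<N} (∑_i v_i E_{i+k}) X^k` is the correlation polynomial of the Stein toolkit
(`hclR_dot_shiftT_pow`) and vectors are read as column polynomials `∑ E_n X^n`, then `f = 0`.
This is `hclR_tail_slot_poly` after `hclR_tail_corr_eq`. -/
theorem hclR_tail_slot :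
    ∀ (N q : ℕ) (w : Fin q → Fin N → ℂ) (η : Fin (q + 3) → Fin N → ℂ) (cst : Fin (q + 3) → ℂ)
      (γ : Fin (q + 3) → Fin q → ℂ[X]) (E : Fin (q + 3) → Fin N → ℂ) (f : Fin N → ℂ),
      (∀ b c, (X : ℂ[X]) ^ N ∣
        C (cst b) * (∑ k ∈ Finset.range N, C (∑ i : Fin N, η b i *
            (if h : (i : ℕ) + k < N then E c ⟨(i : ℕ) + k, h⟩ else 0)) * X ^ k) +
          (∑ l, γ b l * ∑ k ∈ Finset.range N, C (∑ i : Fin N, w l i *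
            (if h : (i : ℕ) + k < N then E c ⟨(i : ℕ) + k, h⟩ else 0)) * X ^ k) -
          (if b = c then ∑ n : Fin N, C (f n) * X ^ (n : ℕ) else 0)) →
      f = 0 := by
  intro N q w η cst γ E f hslot
  have hφ := hclR_tail_slot_poly N q w η cst γ (fun c => ∑ n : Fin N, C (E c n) * X ^ (n : ℕ))
    (∑ n : Fin N, C (f n) * X ^ (n : ℕ))
    (fun c k hk => by rw [hclR_tail_coeff_vp, dif_neg (by omega)])
    (fun k hk => by rw [hclR_tail_coeff_vp, dif_neg (by omega)])
    (fun b c => by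
      have h := hslot b c
      simp only [hclR_tail_corr_eq] at h
      exact h)
  funext n
  have h := congrArg (fun p : ℂ[X] => p.coeff n) hφ
  simp only [hclR_tail_coeff_vp, coeff_zero, dif_pos n.is_lt] at h
  exact h

/-- Stein inversion for a sum of rank-one displacements: if `M - Z M Zᵀ = ∑_j u_j ⊗ v_j` then
`M` is the sum of the rank-one Stein sums `∑_{k<N} Z^k (u_j ⊗ v_j) (Zᵀ)^k`. -/
private theorem r0g_eq_sum_stein {N : ℕ} {ι : Type*} [Fintype ι] (M : Matrix (Fin N) (Fin N) ℂ)
    (u v : ι → Fin N → ℂ)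
    (h : M - (Matrix.of fun i j : Fin N => if (i : ℕ) = (j : ℕ) + 1 then (1 : ℂ) else 0) * M *
      (Matrix.of fun i j : Fin N => if (i : ℕ) = (j : ℕ) + 1 then (1 : ℂ) else 0)ᵀ =
      ∑ j, Matrix.vecMulVec (u j) (v j)) :
    M = ∑ j, ∑ k ∈ Finset.range N,
      (Matrix.of fun i j : Fin N => if (i : ℕ) = (j : ℕ) + 1 then (1 : ℂ) else 0) ^ k *
        Matrix.vecMulVec (u j) (v j) *
        ((Matrix.of fun i j : Fin N => if (i : ℕ) = (j : ℕ) + 1 then (1 : ℂ) else 0)ᵀ) ^ k := by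
  -- adapted from `hclR_eq_stein_sum` (HiddenCornerLemmaRStein)
  set Z := (Matrix.of fun i j : Fin N => if (i : ℕ) = (j : ℕ) + 1 then (1 : ℂ) else 0) with hZ
  set S := ∑ j, ∑ k ∈ Finset.range N, Z ^ k * Matrix.vecMulVec (u j) (v j) * (Zᵀ) ^ k with hS
  have hS' : S - Z * S * Zᵀ = ∑ j, Matrix.vecMulVec (u j) (v j) := by
    rw [hS, Finset.mul_sum, Finset.sum_mul, ← Finset.sum_sub_distrib]
    exact Finset.sum_congr rfl fun j _ => by rw [hZ]; exact hclR_stein_sum (u j) (v j)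
  have hdiff : (M - S) = Z * (M - S) * Zᵀ := by
    have e1 : M - S - Z * (M - S) * Zᵀ = (M - Z * M * Zᵀ) - (S - Z * S * Zᵀ) := by
      simp only [Matrix.mul_sub, Matrix.sub_mul]; abel
    have : M - S - Z * (M - S) * Zᵀ = 0 := by rw [e1, h, hS', sub_self]
    exact sub_eq_zero.mp this
  have := hclR_eq_zero_of_stein (M - S) (by rw [hZ] at hdiff; exact hdiff)
  exact sub_eq_zero.mp this

/-- The shift is multiplication by `X` in the polynomial model: the column polynomial of
`Z^k u` is `X^k · (∑ u_n X^n)` modulo `X^N`. -/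
private theorem r0g_vp_shift_pow {N : ℕ} (k : ℕ) (u : Fin N → ℂ) :
    (X : ℂ[X]) ^ N ∣ (∑ n : Fin N, C (((Matrix.of fun i j : Fin N =>
        if (i : ℕ) = (j : ℕ) + 1 then (1 : ℂ) else 0) ^ k *ᵥ u) n) * X ^ (n : ℕ)) -
      X ^ k * ∑ n : Fin N, C (u n) * X ^ (n : ℕ) := by
  rw [X_pow_dvd_iff]
  intro d hd
  rw [coeff_sub, hclR_tail_coeff_vp, dif_pos hd, hclR_shift_pow_mulVec, coeff_X_pow_mul',
    hclR_tail_coeff_vp]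
  by_cases h : k ≤ d
  · rw [dif_pos h, if_pos h, dif_pos (lt_of_le_of_lt (Nat.sub_le _ _) hd), sub_self]
  · rw [dif_neg h, if_neg h, sub_zero]

/-- One rank-one Stein sum in the polynomial model: the column polynomial of
`(∑_k Z^k (u ⊗ v) (Zᵀ)^k) e` is `(∑ u_n X^n) · corr(v, e)` modulo `X^N`, where
`corr(v, e) = ∑_{k<N} ⟪v, (Zᵀ)^k e⟫ X^k` is the correlation polynomial. -/
private theorem r0g_vp_stein_mulVec {N : ℕ} (u v e : Fin N → ℂ) :
    (X : ℂ[X]) ^ N ∣ (∑ n : Fin N, C (u n) * X ^ (n : ℕ)) *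
        (∑ k ∈ Finset.range N, C (∑ i : Fin N, v i *
          (if h : (i : ℕ) + k < N then e ⟨(i : ℕ) + k, h⟩ else 0)) * X ^ k) -
      ∑ n : Fin N, C (((∑ k ∈ Finset.range N,
        (Matrix.of fun i j : Fin N => if (i : ℕ) = (j : ℕ) + 1 then (1 : ℂ) else 0) ^ k *
          Matrix.vecMulVec u v *
          ((Matrix.of fun i j : Fin N => if (i : ℕ) = (j : ℕ) + 1 then (1 : ℂ) else 0)ᵀ) ^ k) *ᵥ e) n) *
        X ^ (n : ℕ) := by
  rw [hclR_stein_sum_mulVec]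
  simp_rw [hclR_dot_shiftT_pow]
  set Z := (Matrix.of fun i j : Fin N => if (i : ℕ) = (j : ℕ) + 1 then (1 : ℂ) else 0) with hZ
  set c : ℕ → ℂ := fun k => ∑ i : Fin N, v i * (if h : (i : ℕ) + k < N then e ⟨(i : ℕ) + k, h⟩ else 0)
    with hc
  have hvp : (∑ n : Fin N, C ((∑ k ∈ Finset.range N, c k • (Z ^ k *ᵥ u)) n) * X ^ (n : ℕ)) =
      ∑ k ∈ Finset.range N, C (c k) * ∑ n : Fin N, C ((Z ^ k *ᵥ u) n) * X ^ (n : ℕ) := by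
    simp only [Finset.sum_apply, Pi.smul_apply, smul_eq_mul, map_sum, map_mul, Finset.sum_mul,
      Finset.mul_sum]
    rw [Finset.sum_comm]
    exact Finset.sum_congr rfl fun k _ => Finset.sum_congr rfl fun n _ => by ring
  rw [hvp, Finset.mul_sum, ← Finset.sum_sub_distrib]
  refine Finset.dvd_sum fun k _ => ?_
  have h1 := r0g_vp_shift_pow k u
  rw [← hZ] at h1
  have e1 : (∑ n : Fin N, C (u n) * X ^ (n : ℕ)) * (C (c k) * X ^ k) -
      C (c k) * ∑ n : Fin N, C ((Z ^ k *ᵥ u) n) * X ^ (n : ℕ) =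
      -C (c k) * ((∑ n : Fin N, C ((Z ^ k *ᵥ u) n) * X ^ (n : ℕ)) -
        X ^ k * ∑ n : Fin N, C (u n) * X ^ (n : ℕ)) := by ring
  rw [e1]
  exact h1.mul_left _

/-- Corner per coefficient: testing `T(X) E = F X` at `X = single a b 1` gives
`T a b *ᵥ (col c of E) = [b = c] • (col a of F)`. -/
private theorem r0g_corner_col {r N : ℕ} (T : Fin r → Fin r → Matrix (Fin N) (Fin N) ℂ)
    (E F : Matrix (Fin N) (Fin r) ℂ)
    (hcorner : ∀ X : Matrix (Fin r) (Fin r) ℂ, (∑ a : Fin r, ∑ b : Fin r, X a b • T a b) * E = F * X)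
    (a b c : Fin r) :
    T a b *ᵥ (fun i => E i c) = if b = c then (fun i => F i a) else 0 := by
  -- adapted from `blk_corner_col` (HiddenCornerLemmaRStubMixedDeepBound)
  have h1 := hcorner (Matrix.single a b 1)
  have hsum : (∑ a' : Fin r, ∑ b' : Fin r, (Matrix.single a b (1 : ℂ)) a' b' • T a' b') = T a b := by
    rw [Finset.sum_eq_single a]
    · rw [Finset.sum_eq_single b]
      · simp
      · intro b' _ hb'; simp [hb'.symm]
      · simp
    · intro a' _ ha'
      apply Finset.sum_eq_zero; intro b' _
      simp [ha'.symm]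
    · simp
  rw [hsum] at h1
  ext i
  have h2 := congr_fun (congr_fun h1 i) c
  rw [Matrix.mul_apply] at h2
  simp only [Matrix.mulVec, dotProduct]
  rw [h2, Matrix.mul_apply]
  by_cases hbc : b = c
  · subst hbc
    rw [if_pos rfl, Finset.sum_eq_single a]
    · simp
    · intro j _ hj; simp [hj.symm]
    · simp
  · rw [if_neg hbc]
    simp only [Pi.zero_apply]
    apply Finset.sum_eq_zero; intro j _
    simp only [Matrix.single_apply, mul_ite, mul_one, mul_zero, ite_eq_right_iff, and_imp]
    intro _ hbc'; exact absurd hbc' hbc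

/-- **Column identity of the row-`0` mixed class in the polynomial model.**  If
`M - Z M Zᵀ = G₀ H₁ᵀ + G₁ H₀ᵀ` with `G₀ : N × 1` supported on row `0`, then for every vector `e`
the column polynomial of `M e` is
`G₀ 0 0 · corr(h, e) + ∑_l (∑_n (G₁)_{n l} X^n) · corr(w_l, e)` modulo `X^N`
(`h` = the column of `H₁`, `w_l` = column `l` of `H₀`, `corr` the correlation polynomial). -/
private theorem r0g_col_congr {N q : ℕ} (hN : 0 < N) (M : Matrix (Fin N) (Fin N) ℂ)
    (G₀ H₁ : Matrix (Fin N) (Fin 1) ℂ) (G₁ H₀ : Matrix (Fin N) (Fin q) ℂ)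
    (hG₀ : ∀ i : Fin N, (i : ℕ) ≠ 0 → G₀ i 0 = 0)
    (hdisp : M - (Matrix.of fun i j : Fin N => if (i : ℕ) = (j : ℕ) + 1 then (1 : ℂ) else 0) * M *
      (Matrix.of fun i j : Fin N => if (i : ℕ) = (j : ℕ) + 1 then (1 : ℂ) else 0)ᵀ = G₀ * H₁ᵀ + G₁ * H₀ᵀ)
    (e : Fin N → ℂ) :
    (X : ℂ[X]) ^ N ∣
      C (G₀ ⟨0, hN⟩ 0) * (∑ k ∈ Finset.range N, C (∑ i : Fin N, H₁ i 0 *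
          (if h : (i : ℕ) + k < N then e ⟨(i : ℕ) + k, h⟩ else 0)) * X ^ k) +
        (∑ l, (∑ n : Fin N, C (G₁ n l) * X ^ (n : ℕ)) *
          ∑ k ∈ Finset.range N, C (∑ i : Fin N, H₀ i l *
            (if h : (i : ℕ) + k < N then e ⟨(i : ℕ) + k, h⟩ else 0)) * X ^ k) -
        ∑ n : Fin N, C ((M *ᵥ e) n) * X ^ (n : ℕ) := by
  set Z := (Matrix.of fun i j : Fin N => if (i : ℕ) = (j : ℕ) + 1 then (1 : ℂ) else 0) with hZ
  -- the `q + 1` rank-one pieces of the displacement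
  let u : Option (Fin q) → Fin N → ℂ := fun j => j.elim (fun i => G₀ i 0) fun l i => G₁ i l
  let v : Option (Fin q) → Fin N → ℂ := fun j => j.elim (fun i => H₁ i 0) fun l i => H₀ i l
  have hD : G₀ * H₁ᵀ + G₁ * H₀ᵀ = ∑ j, Matrix.vecMulVec (u j) (v j) := by
    ext i j
    rw [Fintype.sum_option, Matrix.add_apply, Matrix.add_apply, Matrix.sum_apply]
    simp [u, v, Matrix.mul_apply, Matrix.vecMulVec_apply]
  rw [hD] at hdisp
  have hM := r0g_eq_sum_stein M u v hdisp
  rw [← hZ] at hM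
  -- column polynomial of `M e`, piece by piece
  have hMe : (∑ n : Fin N, C ((M *ᵥ e) n) * X ^ (n : ℕ)) = ∑ j, ∑ n : Fin N,
      C (((∑ k ∈ Finset.range N, Z ^ k * Matrix.vecMulVec (u j) (v j) * (Zᵀ) ^ k) *ᵥ e) n) *
        X ^ (n : ℕ) := by
    rw [hM, Matrix.sum_mulVec]
    simp only [Finset.sum_apply, map_sum, Finset.sum_mul]
    exact Finset.sum_comm
  have hG₀vp : (∑ n : Fin N, C (G₀ n 0) * X ^ (n : ℕ)) = C (G₀ ⟨0, hN⟩ 0) := by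
    rw [Finset.sum_eq_single ⟨0, hN⟩]
    · simp
    · intro n _ hn
      rw [hG₀ n (fun h => hn (Fin.ext h)), map_zero, zero_mul]
    · simp
  have hsplit : ∑ j, (∑ n : Fin N, C (u j n) * X ^ (n : ℕ)) *
      (∑ k ∈ Finset.range N, C (∑ i : Fin N, v j i *
        (if h : (i : ℕ) + k < N then e ⟨(i : ℕ) + k, h⟩ else 0)) * X ^ k) =
      C (G₀ ⟨0, hN⟩ 0) * (∑ k ∈ Finset.range N, C (∑ i : Fin N, H₁ i 0 *
          (if h : (i : ℕ) + k < N then e ⟨(i : ℕ) + k, h⟩ else 0)) * X ^ k) +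
        (∑ l, (∑ n : Fin N, C (G₁ n l) * X ^ (n : ℕ)) *
          ∑ k ∈ Finset.range N, C (∑ i : Fin N, H₀ i l *
            (if h : (i : ℕ) + k < N then e ⟨(i : ℕ) + k, h⟩ else 0)) * X ^ k) := by
    rw [Fintype.sum_option, ← hG₀vp]
    rfl
  rw [← hsplit, hMe, ← Finset.sum_sub_distrib]
  exact Finset.dvd_sum fun j _ => by rw [hZ]; exact r0g_vp_stein_mulVec (u j) (v j) e

/-- **Row-`0` mixed law with general right generators.**  In the mixed compression class
`∇(T a b) = G₀ (H₁ a b)ᵀ + (G₁ a b) H₀ᵀ` with ONE constant left generator supported on row `0`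
(`G₀ : N × 1`) and `q` ARBITRARY constant right generators `H₀ : N × q`, a hidden corner
`T(X) E = F X` with `rank F = r` has `r ≤ q + 2` — no nonsingularity, no hypothesis on `E`.
(`q + 3` slots would realise the configuration excluded by `hclR_tail_slot`.) -/
theorem hclR_mixed_row0_general_bound (r N q : ℕ) (T : Fin r → Fin r → Matrix (Fin N) (Fin N) ℂ)
    (E F : Matrix (Fin N) (Fin r) ℂ) (G₀ : Matrix (Fin N) (Fin 1) ℂ) (H₀ : Matrix (Fin N) (Fin q) ℂ)
    (H₁ : Fin r → Fin r → Matrix (Fin N) (Fin 1) ℂ) (G₁ : Fin r → Fin r → Matrix (Fin N) (Fin q) ℂ)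
    (hG₀ : ∀ (i : Fin N) (k : Fin 1), (i : ℕ) ≠ 0 → G₀ i k = 0)
    (hF : F.rank = r)
    (hcorner : ∀ X : Matrix (Fin r) (Fin r) ℂ, (∑ a : Fin r, ∑ b : Fin r, X a b • T a b) * E = F * X)
    (hdisp : ∀ a b, T a b - (Matrix.of fun i j : Fin N => if (i : ℕ) = (j : ℕ) + 1 then (1 : ℂ) else 0) *
        T a b * (Matrix.of fun i j : Fin N => if (i : ℕ) = (j : ℕ) + 1 then (1 : ℂ) else 0)ᵀ
        = G₀ * (H₁ a b)ᵀ + G₁ a b * H₀ᵀ) :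
    r ≤ q + 2 := by
  by_contra hr
  push Not at hr
  have hN : 0 < N := by
    rcases Nat.eq_zero_or_pos N with h0 | h0
    · subst h0
      have : F.rank ≤ 0 := by simpa using Matrix.rank_le_card_height F
      omega
    · exact h0
  -- `q + 3` slots `0, …, q + 2 : Fin r`
  let β : Fin (q + 3) → Fin r := fun s => ⟨(s : ℕ), by omega⟩
  have hβ : ∀ s t : Fin (q + 3), β s = β t → s = t := by
    intro s t h
    have := congrArg Fin.val h
    exact Fin.ext this
  have hFcol : ∀ a : Fin r, (fun i => F i a) = 0 := by
    intro a
    refine hclR_tail_slot N q (fun l j => H₀ j l) (fun s j => H₁ a (β s) j 0) (fun _ => G₀ ⟨0, hN⟩ 0)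
      (fun s l => ∑ n : Fin N, C (G₁ a (β s) n l) * X ^ (n : ℕ)) (fun s i => E i (β s))
      (fun i => F i a) ?_
    intro s t
    have h := r0g_col_congr hN (T a (β s)) G₀ (H₁ a (β s)) (G₁ a (β s)) H₀
      (fun i hi => hG₀ i 0 hi) (hdisp a (β s)) (fun i => E i (β t))
    rw [r0g_corner_col T E F hcorner a (β s) (β t)] at h
    by_cases hst : s = t
    · subst hst
      rw [if_pos rfl] at h
      rw [if_pos rfl]
      exact h
    · rw [if_neg (fun h' => hst (hβ s t h'))] at h
      rw [if_neg hst]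
      simpa only [Pi.zero_apply, map_zero, zero_mul, Finset.sum_const_zero] using h
  have hF0 : F = 0 := by
    ext i a
    exact congr_fun (hFcol a) i
  rw [hF0, Matrix.rank_zero] at hF
  omega

end Summit.MatrixMultiplication.MatrixMultiplication.Theorems

/-! ## The registered stub, case `p = 1`, `γ = 0`, general `H₀` -/

namespace Summit.MatrixMultiplication.MatrixMultiplication.Cruxes.HiddenCornerLemmaR.AtkinsonLloydCoreSplit

open Matrix
open Summit.MatrixMultiplication.MatrixMultiplication.Theorems (hclR_mixed_row0_general_bound)

/-- **`stub_mixedDeepBound` for `p = 1` with `G₀` on row `0` and ARBITRARY `H₀`** (the stub's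
exact binders and hypotheses plus `p = 1` and the row-`0` support of `G₀`): `r ≤ q + 2 ≤ 2(p+q)`
by the row-`0` mixed law with general right generators `hclR_mixed_row0_general_bound` (tail
syzygies), which uses only `rank F = r` and the corner identity — the rank hypotheses on `E`,
`G₀`, `H₀`, the nonsingular member and the deep hypothesis are not needed. -/
theorem mixedDeepBound_p_one_row0 :
    ∀ (r N p q : ℕ) (T : Fin r → Fin r → Matrix (Fin N) (Fin N) ℂ) (E F : Matrix (Fin N) (Fin r) ℂ)
    (G₀ : Matrix (Fin N) (Fin p) ℂ) (H₀ : Matrix (Fin N) (Fin q) ℂ)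
    (H₁ : Fin r → Fin r → Matrix (Fin N) (Fin p) ℂ) (G₁ : Fin r → Fin r → Matrix (Fin N) (Fin q) ℂ),
    p = 1 → (∀ (i : Fin N) (k : Fin p), (i : ℕ) ≠ 0 → G₀ i k = 0) →
    0 < q → E.rank = r → F.rank = r → G₀.rank = p → H₀.rank = q →
    (∀ X : Matrix (Fin r) (Fin r) ℂ, (∑ a : Fin r, ∑ b : Fin r, X a b • T a b) * E = F * X) →
    (∀ a b, T a b - (Matrix.of fun i j : Fin N => if (i : ℕ) = (j : ℕ) + 1 then (1 : ℂ) else 0) * T a b * (Matrix.of fun i j : Fin N => if (i : ℕ) = (j : ℕ) + 1 then (1 : ℂ) else 0)ᵀ = G₀ * (H₁ a b)ᵀ + G₁ a b * H₀ᵀ) →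
    (∃ X₀ : Matrix (Fin r) (Fin r) ℂ, (∑ a : Fin r, ∑ b : Fin r, X₀ a b • T a b).det ≠ 0) →
    (∀ c : ℕ, (∀ i : Fin N, (i : ℕ) < c → ∀ k : Fin p, G₀ i k = 0) →
      ∀ (a : Fin r) (i : Fin N), (i : ℕ) < c → F i a = 0) →
    r ≤ 2 * (p + q) := by
  intro r N p q T E F G₀ H₀ H₁ G₁ hp hG₀ _hq _hE hF _hG₀r _hH₀ hcorner hdisp _hns _hdeep
  subst hp
  have hle := hclR_mixed_row0_general_bound r N q T E F G₀ H₀ H₁ G₁ hG₀ hF hcorner hdisp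
  omega

end Summit.MatrixMultiplication.MatrixMultiplication.Cruxes.HiddenCornerLemmaR.AtkinsonLloydCoreSplit
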